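import Mathlib
import Summits.CriticalPhenomena.PercolationContinuityZ3.Theorems.PercNearOneGluingAdditiveGluingPocketBHKStep
import HarnessLib

/-! # Crux `PercNearOneGluing.AdditiveGluing` (stmt-CriticalPhenomena-4576), line `subuniform-dead-pocket-maximum`,
# stub `stub_goodStep` — the pocket-augmented BHK inequality, III: the inequality

Helper file for the crux (prover-siege k9).  **Theorem (pocket-augmented van den Berg–Häggström–Kahn
inequality; new — `pocketCore`, registered sub-goal `stub_pocketBHK_k9`).**  Bernoulli bond percolation with
arbitrary edge probabilities on a finite vertex set, restricted to `U`; `s, o ∈ U`; `X, Y ⊆ U`; `P` a predicate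
on vertex sets holding only on sets `W ∋ o` with `s ∉ W` and `W ∩ X = ∅` ("pockets of the observer `o`
avoiding the source `s` and the forbidden set `X`"); `F := {o ↔ s} ∪ {C(o) ∈ P}` (NOT a monotone event);
`G ≥ 0` an increasing function of the open edge cluster `C_s`.  Then, with `R_X := {s ↮ X}`,
    `E[1_F 1_{R_X}] · E[G(C_s) 1_{R_Y}] ≤ E[1_F G(C_s) 1_{R_{X∩Y}}] · P(R_{X∪Y})`.
For `P ≡ False` this is BHK's Theorem 1.1 (doi:10.1002/rsa.20102, pp. 3–5) with `A = {o ↔ s}`.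
Proof: BHK's strong induction on the vertex set with the Ahlswede–Daykin four functions theorem
(`Literature.Probability.Percolation.BHK2006.core`, followed line by line): the conditioning on the set `S`
of vertices attached to `Z = X ∩ Y` maps the pocket factor to that of `G[U ∖ Z]` for the SHRUNK family
`P ∧ Disjoint · S` (`PocketBHK.step_sumF`), antitone in `S`; the base case `X ∩ Y = ∅` is
`PocketBHK.disj0` (new) followed by two applications of Harris.
Why it matters here: with `X = Y = {a₂}`, `s = a₁`, `G = 1{a₁ ↔ b}` (and symmetrically) it yields the
conditional-covariance inequalities H1/H2 of the lead's analysis of `stub_goodStep`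
(`Cruxes/AdditiveGluing/Lines/subuniform-dead-pocket-maximum-goodstep-c1.md` §3), hence the kernel C1 and
goodness with two relays (sequel).  Paper write-up + exact numerics (0 violations / 6 300 instances):
item evidence `PocketBHK-paper.md`. No definitions. -/

namespace Summit.CriticalPhenomena.PercolationContinuityZ3.Theorems

namespace PocketBHK

open Literature.Probability.Percolation Literature.Probability.Percolation.BHK2006
open DecisionTree (ind ind_of_mem ind_of_not_mem ind_nonneg)
open scoped Classical

noncomputable section

variable {V : Type*} [Fintype V]

/-- **The pocket-augmented van den Berg–Häggström–Kahn inequality** (functional form, percolation restricted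
to `U`; new — see the module docstring).  For `s, o ∈ U`, `X, Y ⊆ U`, a pocket predicate `P` (every `W`
with `P W` satisfies `o ∈ W`, `s ∉ W`, `W ∩ X = ∅`) and `G ≥ 0` increasing:
`E[1_F 1{s↮X}] · E[G(C_s) 1{s↮Y}] ≤ E[1_F G(C_s) 1{s ↮ X∩Y}] · P(s ↮ X∪Y)`, `F = {o ↔ s} ∪ {C(o) ∈ P}`.
[folklore] -/
theorem pocketCore (w : Sym2 V → ℝ) (hw0 : ∀ e, 0 ≤ w e) (hw1 : ∀ e, w e ≤ 1)
    (hm : ∑ ω, weight w ω = 1) (U : Finset V) :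
    ∀ (s : V), s ∈ U → ∀ (o : V), o ∈ U → ∀ (X Y : Set V), X ⊆ ↑U → Y ⊆ ↑U →
    ∀ (P : Set V → Prop), (∀ W, P W → o ∈ W ∧ s ∉ W ∧ ∀ x ∈ X, x ∉ W) →
    ∀ (G : Set (Sym2 V) → ℝ), Monotone G → (∀ a, 0 ≤ G a) →
    (∑ ω, weight w ω * (ind {ξ | (openGraph (ξ ∩ edgesIn U)).Reachable o s ∨
        P (openCluster (ξ ∩ edgesIn U) o)} ω * ind (rD U s X) ω)) *
      (∑ ω, weight w ω * (G (rC U s ω) * ind (rD U s Y) ω)) ≤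
    (∑ ω, weight w ω * (ind {ξ | (openGraph (ξ ∩ edgesIn U)).Reachable o s ∨
        P (openCluster (ξ ∩ edgesIn U) o)} ω * G (rC U s ω) * ind (rD U s (X ∩ Y)) ω)) *
      (∑ ω, weight w ω * ind (rD U s (X ∪ Y)) ω) := by
  induction U using Finset.strongInduction with
  | H U ih =>
  intro s hsU o hoU X Y hXU hYU P hP G hG hG0
  set F : Set (Set (Sym2 V)) :=
    {ξ | (openGraph (ξ ∩ edgesIn U)).Reachable o s ∨ P (openCluster (ξ ∩ edgesIn U) o)} with hF
  -- nonnegativity of the right-hand side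
  have hRHS : 0 ≤ (∑ ω, weight w ω * (ind F ω * G (rC U s ω) * ind (rD U s (X ∩ Y)) ω)) *
      (∑ ω, weight w ω * ind (rD U s (X ∪ Y)) ω) :=
    mul_nonneg (Finset.sum_nonneg fun ω _ => mul_nonneg (weight_nonneg hw0 hw1 ω)
      (mul_nonneg (mul_nonneg (ind_nonneg _ _) (hG0 _)) (ind_nonneg _ _)))
      (Finset.sum_nonneg fun ω _ => mul_nonneg (weight_nonneg hw0 hw1 ω) (ind_nonneg _ _))
  -- trivial cases `s ∈ X`, `s ∈ Y`
  by_cases hsX : s ∈ X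
  · have h0 : ∑ ω, weight w ω * (ind F ω * ind (rD U s X) ω) = 0 :=
      Finset.sum_eq_zero fun ω _ => by
        rw [rD_eq_empty hsX, ind_of_not_mem (Set.notMem_empty ω)]; ring
    rw [h0, zero_mul]; exact hRHS
  by_cases hsY : s ∈ Y
  · have h0 : ∑ ω, weight w ω * (G (rC U s ω) * ind (rD U s Y) ω) = 0 :=
      Finset.sum_eq_zero fun ω _ => by
        rw [rD_eq_empty hsY, ind_of_not_mem (Set.notMem_empty ω)]; ring
    rw [h0, mul_zero]; exact hRHS
  -- `Z := X ∩ Y`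
  set Z : Finset V := U.filter fun v => v ∈ X ∧ v ∈ Y with hZ
  have hZU : Z ⊆ U := Finset.filter_subset _ _
  have hmemZ : ∀ v, v ∈ Z ↔ v ∈ X ∧ v ∈ Y := fun v => by
    simp only [hZ, Finset.mem_filter, and_iff_right_iff_imp]
    exact fun h => hXU h.1
  have hsZ : s ∉ Z := fun h => hsX ((hmemZ s).1 h).1
  rcases Z.eq_empty_or_nonempty with hZe | hZne
  · /- `X ∩ Y = ∅`: the new base case `disj0`, then Harris twice. -/
    have hXY : ∀ ω, ind (rD U s (X ∩ Y)) ω = 1 := fun ω =>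
      ind_of_mem fun x hx _ => by
        have : x ∈ Z := (hmemZ x).2 hx
        rw [hZe] at this
        exact absurd this (Finset.notMem_empty x)
    have hXuY : ∀ ω, ind (rD U s (X ∪ Y)) ω = ind (rD U s X) ω * ind (rD U s Y) ω := fun ω => by
      rw [rD_union, ind_inter]
    simp_rw [hXY, mul_one, hXuY]
    have hGm : Monotone fun ω => G (rC U s ω) := fun a b hab => hG (rC_mono U s hab)
    have hD : (∑ ω, weight w ω * (ind F ω * ind (rD U s X) ω)) * (∑ ω, weight w ω * G (rC U s ω)) ≤
        (∑ ω, weight w ω * (ind F ω * G (rC U s ω))) * (∑ ω, weight w ω * ind (rD U s X) ω) :=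
      disj0 w hw0 hw1 hm hoU X P G hG hG0
    have h2 : ∑ ω, weight w ω * (G (rC U s ω) * ind (rD U s Y) ω) ≤
        (∑ ω, weight w ω * G (rC U s ω)) * ∑ ω, weight w ω * ind (rD U s Y) ω :=
      harris_mono_anti hw0 hw1 hm (fun _ => hG0 _) hGm
        (ind_rD_antitone U s Y) (fun _ => ind_le_one _ _)
    have h4 : (∑ ω, weight w ω * ind (rD U s X) ω) * (∑ ω, weight w ω * ind (rD U s Y) ω) ≤
        ∑ ω, weight w ω * (ind (rD U s X) ω * ind (rD U s Y) ω) :=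
      harris_anti_anti hw0 hw1 hm
        (ind_rD_antitone U s X) (ind_rD_antitone U s Y) (fun _ => ind_le_one _ _)
        (fun _ => ind_le_one _ _)
    have hA1 : 0 ≤ ∑ ω, weight w ω * (ind F ω * ind (rD U s X) ω) :=
      Finset.sum_nonneg fun ω _ => mul_nonneg (weight_nonneg hw0 hw1 ω)
        (mul_nonneg (ind_nonneg _ _) (ind_nonneg _ _))
    have hA3 : 0 ≤ ∑ ω, weight w ω * (ind F ω * G (rC U s ω)) :=
      Finset.sum_nonneg fun ω _ => mul_nonneg (weight_nonneg hw0 hw1 ω)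
        (mul_nonneg (ind_nonneg _ _) (hG0 _))
    have hYn : 0 ≤ ∑ ω, weight w ω * ind (rD U s Y) ω :=
      Finset.sum_nonneg fun ω _ => mul_nonneg (weight_nonneg hw0 hw1 ω) (ind_nonneg _ _)
    calc (∑ ω, weight w ω * (ind F ω * ind (rD U s X) ω)) *
          (∑ ω, weight w ω * (G (rC U s ω) * ind (rD U s Y) ω))
        ≤ (∑ ω, weight w ω * (ind F ω * ind (rD U s X) ω)) *
          ((∑ ω, weight w ω * G (rC U s ω)) * ∑ ω, weight w ω * ind (rD U s Y) ω) :=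
          mul_le_mul_of_nonneg_left h2 hA1
      _ = ((∑ ω, weight w ω * (ind F ω * ind (rD U s X) ω)) *
          (∑ ω, weight w ω * G (rC U s ω))) * ∑ ω, weight w ω * ind (rD U s Y) ω := by ring
      _ ≤ ((∑ ω, weight w ω * (ind F ω * G (rC U s ω))) *
          (∑ ω, weight w ω * ind (rD U s X) ω)) * ∑ ω, weight w ω * ind (rD U s Y) ω :=
          mul_le_mul_of_nonneg_right hD hYn
      _ = (∑ ω, weight w ω * (ind F ω * G (rC U s ω))) *
          ((∑ ω, weight w ω * ind (rD U s X) ω) * ∑ ω, weight w ω * ind (rD U s Y) ω) := by ring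
      _ ≤ (∑ ω, weight w ω * (ind F ω * G (rC U s ω))) *
          ∑ ω, weight w ω * (ind (rD U s X) ω * ind (rD U s Y) ω) :=
          mul_le_mul_of_nonneg_left h4 hA3
  · /- `Z ≠ ∅`.  If `o ∈ Z` the pocket factor vanishes on `R_X`; otherwise condition on `S` and apply the
    four functions theorem with the induction hypothesis on `U ∖ Z`, for the shrunk family. -/
    have hZX : (↑Z : Set V) ⊆ X := fun v hv => ((hmemZ v).1 hv).1
    have hZY : (↑Z : Set V) ⊆ Y := fun v hv => ((hmemZ v).1 hv).2
    have hZXY : (↑Z : Set V) ⊆ X ∩ Y := fun v hv => (hmemZ v).1 hv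
    have hZXuY : (↑Z : Set V) ⊆ X ∪ Y := fun v hv => Or.inl (((hmemZ v).1 hv).1)
    by_cases hoZ : o ∈ Z
    · have hoX : o ∈ X := hZX hoZ
      have h0 : ∑ ω, weight w ω * (ind F ω * ind (rD U s X) ω) = 0 := by
        refine Finset.sum_eq_zero fun ω _ => ?_
        by_cases hω : ω ∈ rD U s X
        · have hFω : ω ∉ F := by
            rintro (hr | hPK)
            · exact hω o hoX hr.symm
            · exact (hP _ hPK).2.2 o hoX (mem_openCluster_self _ o)
          rw [ind_of_not_mem hFω]; ring
        · rw [ind_of_not_mem hω]; ring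
      rw [h0, zero_mul]; exact hRHS
    have hss : U \ Z ⊂ U := Finset.sdiff_ssubset hZU hZne
    have hsU' : s ∈ U \ Z := Finset.mem_sdiff.2 ⟨hsU, hsZ⟩
    have hoU' : o ∈ U \ Z := Finset.mem_sdiff.2 ⟨hoU, hoZ⟩
    have hPZ : ∀ K, P K → ∀ z ∈ Z, z ∉ K := fun K hK z hz => (hP K hK).2.2 z (hZX hz)
    -- the pocket event of `G[U ∖ Z]` for the family shrunk by the forbidden set `T`
    set F' : Set V → Set (Set (Sym2 V)) := fun T =>
      {ξ | (openGraph (ξ ∩ edgesIn (U \ Z))).Reachable o s ∨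
        (P (openCluster (ξ ∩ edgesIn (U \ Z)) o) ∧ Disjoint (openCluster (ξ ∩ edgesIn (U \ Z)) o) T)}
      with hF'
    -- the four block expectations as functions of the attachment set `T`
    set f1 : Set V → ℝ := fun T =>
      ∑ η, weight w η * (ind (F' T) η * ind (rD (U \ Z) s ((X \ ↑Z) ∪ T)) η) with hf1
    set f2 : Set V → ℝ := fun T => blockE w (U \ Z) s G (Y \ ↑Z) T with hf2
    set f3 : Set V → ℝ := fun T =>
      ∑ η, weight w η * (ind (F' T) η * G (rC (U \ Z) s η) * ind (rD (U \ Z) s (((X ∩ Y) \ ↑Z) ∪ T)) η)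
      with hf3
    set f4 : Set V → ℝ := fun T => blockE w (U \ Z) s (fun _ => 1) ((X ∪ Y) \ ↑Z) T with hf4
    have hf1n : ∀ T, 0 ≤ f1 T := fun T => Finset.sum_nonneg fun η _ =>
      mul_nonneg (weight_nonneg hw0 hw1 η) (mul_nonneg (ind_nonneg _ _) (ind_nonneg _ _))
    have hf3n : ∀ T, 0 ≤ f3 T := fun T => Finset.sum_nonneg fun η _ =>
      mul_nonneg (weight_nonneg hw0 hw1 η) (mul_nonneg (mul_nonneg (ind_nonneg _ _) (hG0 _)) (ind_nonneg _ _))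
    -- the four sums, conditioned on `S`
    have e1 : ∑ ω, weight w ω * (ind F ω * ind (rD U s X) ω) = ∑ ω, weight w ω * f1 (rS U Z ω) := by
      have := step_sumF hZU hoZ hsZ hZX hPZ w hm (fun _ => (1 : ℝ))
      simpa only [mul_one] using this
    have e2 : ∑ ω, weight w ω * (G (rC U s ω) * ind (rD U s Y) ω) = ∑ ω, weight w ω * f2 (rS U Z ω) :=
      step_sum hZU hsZ hZY w hm G
    have e3 : ∑ ω, weight w ω * (ind F ω * G (rC U s ω) * ind (rD U s (X ∩ Y)) ω) =
        ∑ ω, weight w ω * f3 (rS U Z ω) :=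
      step_sumF hZU hoZ hsZ hZXY hPZ w hm G
    have e4 : ∑ ω, weight w ω * ind (rD U s (X ∪ Y)) ω = ∑ ω, weight w ω * f4 (rS U Z ω) := by
      have := step_sum hZU hsZ hZXuY w hm (fun _ => 1)
      simpa only [one_mul] using this
    rw [e1, e2, e3, e4]
    refine four_functions_theorem_univ
      (fun ω => weight w ω * f1 (rS U Z ω)) (fun ω => weight w ω * f2 (rS U Z ω))
      (fun ω => weight w ω * f3 (rS U Z ω)) (fun ω => weight w ω * f4 (rS U Z ω))
      (fun ω => mul_nonneg (weight_nonneg hw0 hw1 ω) (hf1n _))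
      (fun ω => mul_nonneg (weight_nonneg hw0 hw1 ω) (blockE_nonneg hw0 hw1 _ _ hG0 _ _))
      (fun ω => mul_nonneg (weight_nonneg hw0 hw1 ω) (hf3n _))
      (fun ω => mul_nonneg (weight_nonneg hw0 hw1 ω)
        (blockE_nonneg hw0 hw1 _ _ (fun _ => zero_le_one) _ _))
      fun a b => ?_
    -- the Ahlswede–Daykin hypothesis: weight lattice identity × induction hypothesis for the shrunk family
    set Sa := rS U Z a with hSa
    set Sb := rS U Z b with hSb
    have hSaU : Sa ⊆ ↑(U \ Z) := rS_subset U Z a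
    have hSbU : Sb ⊆ ↑(U \ Z) := rS_subset U Z b
    have hX1 : X \ ↑Z ∪ Sa ⊆ ↑(U \ Z) := Set.union_subset
      (fun v hv => by rw [Finset.coe_sdiff]; exact ⟨hXU hv.1, hv.2⟩) hSaU
    have hY1 : Y \ ↑Z ∪ Sb ⊆ ↑(U \ Z) := Set.union_subset
      (fun v hv => by rw [Finset.coe_sdiff]; exact ⟨hYU hv.1, hv.2⟩) hSbU
    have hP' : ∀ W, (P W ∧ Disjoint W Sa) → o ∈ W ∧ s ∉ W ∧ ∀ x ∈ X \ ↑Z ∪ Sa, x ∉ W := by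
      rintro W ⟨hPW, hd⟩
      refine ⟨(hP W hPW).1, (hP W hPW).2.1, ?_⟩
      rintro x (hx | hx) hxW
      · exact (hP W hPW).2.2 x hx.1 hxW
      · exact Set.disjoint_left.1 hd hxW hx
    have IH := ih (U \ Z) hss s hsU' o hoU' (X \ ↑Z ∪ Sa) (Y \ ↑Z ∪ Sb) hX1 hY1
      (fun K => P K ∧ Disjoint K Sa) hP' G hG hG0
    -- monotonicity in the conditioning sets and in the forbidden set of the family
    have hsub3 : (X ∩ Y) \ ↑Z ∪ rS U Z (a ∩ b) ⊆ (X \ ↑Z ∪ Sa) ∩ (Y \ ↑Z ∪ Sb) := by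
      refine Set.union_subset (fun v hv => ⟨Or.inl ⟨hv.1.1, hv.2⟩, Or.inl ⟨hv.1.2, hv.2⟩⟩) ?_
      exact fun v hv =>
        ⟨Or.inr (rS_inter_subset U Z a b hv).1, Or.inr (rS_inter_subset U Z a b hv).2⟩
    have hsub4 : (X ∪ Y) \ ↑Z ∪ rS U Z (a ∪ b) ⊆ (X \ ↑Z ∪ Sa) ∪ (Y \ ↑Z ∪ Sb) := by
      rw [rS_union]
      rintro v (⟨hXY | hXY, hvZ⟩ | hS | hS)
      · exact Or.inl (Or.inl ⟨hXY, hvZ⟩)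
      · exact Or.inr (Or.inl ⟨hXY, hvZ⟩)
      · exact Or.inl (Or.inr hS)
      · exact Or.inr (Or.inr hS)
    have hSab : rS U Z (a ∩ b) ⊆ Sa := fun v hv => (rS_inter_subset U Z a b hv).1
    have h3 : ∑ ω, weight w ω * (ind (F' Sa) ω * G (rC (U \ Z) s ω) *
        ind (rD (U \ Z) s ((X \ ↑Z ∪ Sa) ∩ (Y \ ↑Z ∪ Sb))) ω) ≤ f3 (rS U Z (a ∩ b)) :=
      Finset.sum_le_sum fun ω _ => mul_le_mul_of_nonneg_left
        (mul_le_mul (mul_le_mul_of_nonneg_right (ind_rF_disjoint_anti (U \ Z) o s P hSab ω) (hG0 _))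
          (ind_mono (rD_antitone hsub3) ω) (ind_nonneg _ _)
          (mul_nonneg (ind_nonneg _ _) (hG0 _)))
        (weight_nonneg hw0 hw1 ω)
    have h4 : ∑ ω, weight w ω * ind (rD (U \ Z) s ((X \ ↑Z ∪ Sa) ∪ (Y \ ↑Z ∪ Sb))) ω ≤
        f4 (rS U Z (a ∪ b)) := by
      have := sum_ind_mono hw0 hw1 (h := fun _ => (1 : ℝ)) (fun _ => zero_le_one)
        (rD_antitone (U := U \ Z) (s := s) hsub4) (w := w)
      simp only [one_mul] at this
      simpa only [hf4, blockE, one_mul] using this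
    have hn3 : 0 ≤ ∑ ω, weight w ω * (ind (F' Sa) ω * G (rC (U \ Z) s ω) *
        ind (rD (U \ Z) s ((X \ ↑Z ∪ Sa) ∩ (Y \ ↑Z ∪ Sb))) ω) :=
      Finset.sum_nonneg fun ω _ => mul_nonneg (weight_nonneg hw0 hw1 ω)
        (mul_nonneg (mul_nonneg (ind_nonneg _ _) (hG0 _)) (ind_nonneg _ _))
    have hIH' : f1 Sa * f2 Sb ≤ f3 (rS U Z (a ∩ b)) * f4 (rS U Z (a ∪ b)) :=
      IH.trans (mul_le_mul h3 h4 (Finset.sum_nonneg fun ω _ =>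
        mul_nonneg (weight_nonneg hw0 hw1 ω) (ind_nonneg _ _)) (hf3n _))
    have hwab := weight_inter_mul_union w a b
    show weight w a * f1 Sa * (weight w b * f2 Sb) ≤
      weight w (a ∩ b) * f3 (rS U Z (a ∩ b)) * (weight w (a ∪ b) * f4 (rS U Z (a ∪ b)))
    calc weight w a * f1 Sa * (weight w b * f2 Sb)
        = (weight w a * weight w b) * (f1 Sa * f2 Sb) := by ring
      _ ≤ (weight w (a ∩ b) * weight w (a ∪ b)) * (f3 (rS U Z (a ∩ b)) * f4 (rS U Z (a ∪ b))) := by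
          rw [hwab]
          exact mul_le_mul_of_nonneg_left hIH'
            (mul_nonneg (weight_nonneg hw0 hw1 _) (weight_nonneg hw0 hw1 _))
      _ = _ := by ring

end

end PocketBHK

/-- **Registered sub-goal `stub_pocketBHK_k9` of `stub_goodStep` (siege k9): the pocket-augmented
van den Berg–Häggström–Kahn inequality** (= `PocketBHK.pocketCore`, closed form over the BHK2006 finite-sum
framework).  For product weights `w ∈ [0,1]` of total mass `1`, `s, o ∈ U`, `X, Y ⊆ U`, a pocket predicate
`P` and `G ≥ 0` increasing: `E[1_F 1{s↮X}] · E[G(C_s) 1{s↮Y}] ≤ E[1_F G(C_s) 1{s↮X∩Y}] · P(s↮X∪Y)` with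
`F = {o ↔ s} ∪ {C(o) ∈ P}`. [folklore] -/
theorem stub_pocketBHK_k9 : ∀ (V : Type) [Fintype V] (w : Sym2 V → ℝ), (∀ e, 0 ≤ w e) →
    (∀ e, w e ≤ 1) → ∑ ω, Literature.Probability.Percolation.BHK2006.weight w ω = 1 →
    ∀ (U : Finset V) (s : V), s ∈ U → ∀ (o : V), o ∈ U → ∀ (X Y : Set V), X ⊆ ↑U → Y ⊆ ↑U →
    ∀ (P : Set V → Prop), (∀ W, P W → o ∈ W ∧ s ∉ W ∧ ∀ x ∈ X, x ∉ W) →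
    ∀ (G : Set (Sym2 V) → ℝ), Monotone G → (∀ a, 0 ≤ G a) →
    (∑ ω, Literature.Probability.Percolation.BHK2006.weight w ω *
        (Literature.Probability.Percolation.DecisionTree.ind {ξ : Set (Sym2 V) |
            (Literature.Probability.Percolation.openGraph
              (ξ ∩ Literature.Probability.Percolation.BHK2006.edgesIn U)).Reachable o s ∨
            P (Literature.Probability.Percolation.openCluster
              (ξ ∩ Literature.Probability.Percolation.BHK2006.edgesIn U) o)} ω *
          Literature.Probability.Percolation.DecisionTree.ind
            (Literature.Probability.Percolation.BHK2006.rD U s X) ω)) *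
      (∑ ω, Literature.Probability.Percolation.BHK2006.weight w ω *
        (G (Literature.Probability.Percolation.BHK2006.rC U s ω) *
          Literature.Probability.Percolation.DecisionTree.ind
            (Literature.Probability.Percolation.BHK2006.rD U s Y) ω)) ≤
    (∑ ω, Literature.Probability.Percolation.BHK2006.weight w ω *
        (Literature.Probability.Percolation.DecisionTree.ind {ξ : Set (Sym2 V) |
            (Literature.Probability.Percolation.openGraph
              (ξ ∩ Literature.Probability.Percolation.BHK2006.edgesIn U)).Reachable o s ∨
            P (Literature.Probability.Percolation.openCluster
              (ξ ∩ Literature.Probability.Percolation.BHK2006.edgesIn U) o)} ω *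
          G (Literature.Probability.Percolation.BHK2006.rC U s ω) *
          Literature.Probability.Percolation.DecisionTree.ind
            (Literature.Probability.Percolation.BHK2006.rD U s (X ∩ Y)) ω)) *
      (∑ ω, Literature.Probability.Percolation.BHK2006.weight w ω *
        Literature.Probability.Percolation.DecisionTree.ind
          (Literature.Probability.Percolation.BHK2006.rD U s (X ∪ Y)) ω) :=
  fun _ _ w hw0 hw1 hm U => PocketBHK.pocketCore w hw0 hw1 hm U

end Summit.CriticalPhenomena.PercolationContinuityZ3.Theorems
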